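import Summits.ResolutionOfSingularities.ResolutionOfSingularities.Theorems.WeightedInvariantWeightedConstructionFatPointHull
import Summits.ResolutionOfSingularities.ResolutionOfSingularities.Theorems.WeightedInvariantWeightedConstructionHullEscapeHull
import Summits.ResolutionOfSingularities.ResolutionOfSingularities.Theorems.WeightedInvariantWeightedConstructionSingularLocusComap
import Summits.ResolutionOfSingularities.ResolutionOfSingularities.Theorems.DatumToEmbedded.Negative.LoadBearingHypotheses
import Literature.AlgebraicGeometry.Resolution.IdealSheafLemmas

/-!
# Fat pairs `Fₘ ⊔ Fₘ'`: the two halves, the singular points, and the rule's centre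

[OURS · L1 W4.3 · chain w43, stub worker 4] Geometry of the witness family of the ESCAPE-CHAIN finding
for crux `WeightedConstruction` (stmt-ResolutionOfSingularities-0571) — interface point (γ) of
`Cruxes/WeightedConstruction/STRATEGY-CENSUS.md` §6 («one well-ordered `Γ` for all dimensions»), door
census (T1) of `L/w43/CHAIN.md`; consumed by `Theorems/…FatPairEscape.lean`. NOT a statement of any
manuscript.

THE FAT PAIRS. For a field `k` and `m, m' ≥ 1` the pair `T(m, m') := Fₘ ⊔ Fₘ'` is the AFFINE `k`-scheme
`Spec (k[x₁,…,xₘ] × k[y₁,…,yₘ'])` — smooth (`smooth_specMap_algebraMap_prod`: glue the smooth halves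
along Mathlib's `coprodSpec : Spec R ⨿ Spec S ≅ Spec (R × S)`), separated and quasi-compact over `k` —
with the ideal sheaf of `𝔪₀² × 𝔪₀²`. Its two halves are the open immersions `Spec fst`, `Spec snd`
(`isOpenImmersion_specMap_fst/snd`, points `specMap_fst/snd_apply`, jointly surjective
`exists_specMap_fst_or_snd_eq`, disjoint `specMap_fst_ne_specMap_snd`), which pull the ideal sheaf back
to the fat points `Fₘ = (𝔸ᵐ, 𝔪₀²)`, `Fₘ' = (𝔸ᵐ', 𝔪₀²)` (`comap_specMap_fst/snd_ofIdealTop_prod`) and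
factor the structure maps (`specMap_fst/snd_comp_specMap_algebraMap`).

* `xSing_fatPair_iff`: the singular points of `T(m, m')` are exactly the two origins `inl 0ₘ`, `inr 0ₘ'`
  (singular locus under smooth pull-back, `xSing_comap_iff_of_smooth`, + the fat point
  `xSing_fatPoint_iff`, p470274).
* `LexmaxHullRule.hull_fatPair_inl/inr`: for every rule `R : LexmaxHullRule p` with `R.HullComap` (stub B
  of the retired line `pointwise-lexmax-hull`) the hull of `T(m, m')` at `inl 0ₘ` is `(2,…,2[m],⊤,…)` and
  at `inr 0ₘ'` is `(2,…,2[m'],⊤,…)` (`hull_fatPoint_eq`, p470675).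
* `LexmaxHullRule.centre_support_fatPair`: hence for `1 ≤ m < m'` the rule's centre on `T(m, m')` is
  supported EXACTLY on `{inl 0ₘ}` — the smaller fat point, whose truncated profile is the larger
  (`twoProfile_lt_of_lt`, p467634; `centre_support_eq_singleton_of_hull_lt`, p470623).
-/

noncomputable section

open CategoryTheory CategoryTheory.Limits AlgebraicGeometry Topology
open Literature.AlgebraicGeometry.Resolution

set_option linter.dupNamespace false -- mandated namespace of this single-conjunct summit

namespace Summit.ResolutionOfSingularities.ResolutionOfSingularities.Theorems.PointwiseLexmaxHull

/-! ## The two halves of `Spec (R × S)` -/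

section ProdPair

variable (R S : Type) [CommRing R] [CommRing S]

/-- The left half `Spec fst : Spec R → Spec (R × S)` on points: `𝔭 ↦ 𝔭 × S`. [folklore] -/
theorem specMap_fst_apply (x : Spec (.of R)) :
    Spec.map (CommRingCat.ofHom (RingHom.fst R S)) x =
      (⟨x.asIdeal.prod ⊤, Ideal.isPrime_ideal_prod_top⟩ : Spec (.of (R × S))) := by
  apply PrimeSpectrum.ext
  change Ideal.comap _ _ = x.asIdeal.prod ⊤
  ext; simp [Ideal.prod, CommRingCat.ofHom]

/-- The right half `Spec snd : Spec S → Spec (R × S)` on points: `𝔮 ↦ R × 𝔮`. [folklore] -/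
theorem specMap_snd_apply (y : Spec (.of S)) :
    Spec.map (CommRingCat.ofHom (RingHom.snd R S)) y =
      (⟨Ideal.prod ⊤ y.asIdeal, Ideal.isPrime_ideal_prod_top'⟩ : Spec (.of (R × S))) := by
  apply PrimeSpectrum.ext
  change Ideal.comap _ _ = Ideal.prod ⊤ y.asIdeal
  ext; simp [Ideal.prod, CommRingCat.ofHom]

/-- Every point of `Spec (R × S)` lies in one of the two halves. [folklore] -/
theorem exists_specMap_fst_or_snd_eq (z : Spec (.of (R × S))) :
    (∃ x : Spec (.of R), Spec.map (CommRingCat.ofHom (RingHom.fst R S)) x = z) ∨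
      (∃ y : Spec (.of S), Spec.map (CommRingCat.ofHom (RingHom.snd R S)) y = z) := by
  rcases (Ideal.ideal_prod_prime z.asIdeal).mp z.isPrime with ⟨q, hq, hz⟩ | ⟨q, hq, hz⟩
  · left
    refine ⟨⟨q, hq⟩, ?_⟩
    rw [specMap_fst_apply]
    exact PrimeSpectrum.ext hz.symm
  · right
    refine ⟨⟨q, hq⟩, ?_⟩
    rw [specMap_snd_apply]
    exact PrimeSpectrum.ext hz.symm

/-- The two halves are disjoint: no point of the left half is a point of the right half. [folklore] -/
theorem specMap_fst_ne_specMap_snd [Nontrivial R] (x : Spec (.of R)) (y : Spec (.of S)) :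
    Spec.map (CommRingCat.ofHom (RingHom.fst R S)) x ≠
      Spec.map (CommRingCat.ofHom (RingHom.snd R S)) y := by
  rw [specMap_fst_apply, specMap_snd_apply]
  intro h
  have h' := congrArg (fun z : Spec (.of (R × S)) => z.asIdeal) h
  simp only at h'
  have hmem : ((1 : R), (0 : S)) ∈ Ideal.prod ⊤ y.asIdeal :=
    ⟨Submodule.mem_top, Ideal.zero_mem _⟩
  rw [← h'] at hmem
  exact x.isPrime.ne_top ((Ideal.eq_top_iff_one _).mpr hmem.1)

/-- The left half is an open immersion. [folklore] -/
theorem isOpenImmersion_specMap_fst :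
    IsOpenImmersion (Spec.map (CommRingCat.ofHom (RingHom.fst R S))) :=
  letI := (RingHom.fst R S).toAlgebra
  IsOpenImmersion.of_isLocalization (1, 0)

/-- The right half is an open immersion. [folklore] -/
theorem isOpenImmersion_specMap_snd :
    IsOpenImmersion (Spec.map (CommRingCat.ofHom (RingHom.snd R S))) :=
  letI := (RingHom.snd R S).toAlgebra
  IsOpenImmersion.of_isLocalization (0, 1)

/-- Pulling the ideal sheaf of `I × J` back to the left half gives the ideal sheaf of `I`. [folklore] -/
theorem comap_specMap_fst_ofIdealTop_prod (I : Ideal R) (J : Ideal S) :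
    (Scheme.IdealSheafData.ofIdealTop
        ((I.prod J).map (Scheme.ΓSpecIso (.of (R × S))).inv.hom)).comap
        (Spec.map (CommRingCat.ofHom (RingHom.fst R S))) =
      Scheme.IdealSheafData.ofIdealTop (I.map (Scheme.ΓSpecIso (.of R)).inv.hom) := by
  rw [comap_ofIdealTop_SpecMap, Ideal.map_fst_prod]

/-- Pulling the ideal sheaf of `I × J` back to the right half gives the ideal sheaf of `J`. [folklore] -/
theorem comap_specMap_snd_ofIdealTop_prod (I : Ideal R) (J : Ideal S) :
    (Scheme.IdealSheafData.ofIdealTop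
        ((I.prod J).map (Scheme.ΓSpecIso (.of (R × S))).inv.hom)).comap
        (Spec.map (CommRingCat.ofHom (RingHom.snd R S))) =
      Scheme.IdealSheafData.ofIdealTop (J.map (Scheme.ΓSpecIso (.of S)).inv.hom) := by
  rw [comap_ofIdealTop_SpecMap, Ideal.map_snd_prod]

/-- The structure map of the left half factors through the pair. [folklore] -/
theorem specMap_fst_comp_specMap_algebraMap (k : Type) [CommRing k] [Algebra k R] [Algebra k S] :
    Spec.map (CommRingCat.ofHom (RingHom.fst R S)) ≫
        Spec.map (CommRingCat.ofHom (algebraMap k (R × S))) =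
      Spec.map (CommRingCat.ofHom (algebraMap k R)) := by
  rw [← Spec.map_comp, ← CommRingCat.ofHom_comp]
  rfl

/-- The structure map of the right half factors through the pair. [folklore] -/
theorem specMap_snd_comp_specMap_algebraMap (k : Type) [CommRing k] [Algebra k R] [Algebra k S] :
    Spec.map (CommRingCat.ofHom (RingHom.snd R S)) ≫
        Spec.map (CommRingCat.ofHom (algebraMap k (R × S))) =
      Spec.map (CommRingCat.ofHom (algebraMap k S)) := by
  rw [← Spec.map_comp, ← CommRingCat.ofHom_comp]
  rfl

/-- `Spec (R × S) → Spec k` is smooth when both halves are. [folklore] -/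
theorem smooth_specMap_algebraMap_prod (k : Type) [CommRing k] [Algebra k R] [Algebra k S]
    (hR : Smooth (Spec.map (CommRingCat.ofHom (algebraMap k R))))
    (hS : Smooth (Spec.map (CommRingCat.ofHom (algebraMap k S)))) :
    Smooth (Spec.map (CommRingCat.ofHom (algebraMap k (R × S)))) := by
  have e : coprodSpec R S ≫ Spec.map (CommRingCat.ofHom (algebraMap k (R × S))) =
      coprod.desc (Spec.map (CommRingCat.ofHom (algebraMap k R)))
        (Spec.map (CommRingCat.ofHom (algebraMap k S))) := by
    apply coprod.hom_ext
    · rw [coprod.inl_desc, coprodSpec_inl_assoc, specMap_fst_comp_specMap_algebraMap]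
    · rw [coprod.inr_desc, coprodSpec_inr_assoc, specMap_snd_comp_specMap_algebraMap]
  have hdesc : Smooth (coprod.desc (Spec.map (CommRingCat.ofHom (algebraMap k R)))
      (Spec.map (CommRingCat.ofHom (algebraMap k S)))) := by
    refine IsZariskiLocalAtSource.of_openCover (P := @Smooth)
      (coprodOpenCover.{0, 0} (Spec (.of R)) (Spec (.of S))) ?_
    rintro (⟨⟨⟩⟩ | ⟨⟨⟩⟩)
    · change Smooth (coprod.inl ≫ coprod.desc _ _)
      rw [coprod.inl_desc]
      exact hR
    · change Smooth (coprod.inr ≫ coprod.desc _ _)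
      rw [coprod.inr_desc]
      exact hS
  rw [← e] at hdesc
  exact (MorphismProperty.cancel_left_of_respectsIso @Smooth (coprodSpec R S) _).mp hdesc

end ProdPair

/-! ## The fat pairs `T(m, m') = Fₘ ⊔ Fₘ'` over a field: singular points and transfer -/

section FatPair

variable (k : Type) [Field k]

/-- **Singular locus of a fat pair** (`1 ≤ m, m'`): a point of
`(Spec (k[x₁,…,xₘ] × k[y₁,…,yₘ']), 𝔪₀² × 𝔪₀²)` is singular iff it is one of the two origins.
[OURS · folklore] -/
theorem xSing_fatPair_iff {m m' : ℕ} (hm : 1 ≤ m) (hm' : 1 ≤ m')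
    (z : Spec (.of (MvPolynomial (Fin m) k × MvPolynomial (Fin m') k))) :
    XSing (Scheme.IdealSheafData.ofIdealTop
        ((((RingHom.ker (MvPolynomial.constantCoeff : MvPolynomial (Fin m) k →+* k)) ^ 2).prod
            ((RingHom.ker (MvPolynomial.constantCoeff : MvPolynomial (Fin m') k →+* k)) ^ 2)).map
          (Scheme.ΓSpecIso (.of (MvPolynomial (Fin m) k × MvPolynomial (Fin m') k))).inv.hom)) z ↔
      z = Spec.map (CommRingCat.ofHom (RingHom.fst _ _))
          (⟨RingHom.ker (MvPolynomial.constantCoeff : MvPolynomial (Fin m) k →+* k),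
            RingHom.ker_isPrime _⟩ : Spec (.of (MvPolynomial (Fin m) k))) ∨
      z = Spec.map (CommRingCat.ofHom (RingHom.snd _ _))
          (⟨RingHom.ker (MvPolynomial.constantCoeff : MvPolynomial (Fin m') k →+* k),
            RingHom.ker_isPrime _⟩ : Spec (.of (MvPolynomial (Fin m') k))) := by
  set A := MvPolynomial (Fin m) k with hA
  set B := MvPolynomial (Fin m') k with hB
  have hsA : Smooth (Spec.map (CommRingCat.ofHom (algebraMap k A))) :=
    DatumToEmbedded.Negative.smooth_affineSpace k m
  have hsB : Smooth (Spec.map (CommRingCat.ofHom (algebraMap k B))) :=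
    DatumToEmbedded.Negative.smooth_affineSpace k m'
  haveI := hsA
  haveI := hsB
  haveI : Smooth (Spec.map (CommRingCat.ofHom (algebraMap k (A × B)))) :=
    smooth_specMap_algebraMap_prod A B k hsA hsB
  haveI := isOpenImmersion_specMap_fst A B
  haveI := isOpenImmersion_specMap_snd A B
  set X := Scheme.IdealSheafData.ofIdealTop
        ((((RingHom.ker (MvPolynomial.constantCoeff : A →+* k)) ^ 2).prod
            ((RingHom.ker (MvPolynomial.constantCoeff : B →+* k)) ^ 2)).map
          (Scheme.ΓSpecIso (.of (A × B))).inv.hom) with hX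
  have hl : ∀ x : Spec (.of A), XSing X (Spec.map (CommRingCat.ofHom (RingHom.fst A B)) x) ↔
      x = ⟨RingHom.ker (MvPolynomial.constantCoeff : A →+* k), RingHom.ker_isPrime _⟩ := by
    intro x
    rw [← xSing_fatPoint_iff hm x, hX, ← comap_specMap_fst_ofIdealTop_prod A B]
    exact (xSing_comap_iff_of_smooth (Spec.map (CommRingCat.ofHom (algebraMap k (A × B))))
      (Spec.map (CommRingCat.ofHom (algebraMap k A))) (Spec.map (CommRingCat.ofHom (RingHom.fst A B)))
      (specMap_fst_comp_specMap_algebraMap A B k) _ x).symm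
  have hr : ∀ y : Spec (.of B), XSing X (Spec.map (CommRingCat.ofHom (RingHom.snd A B)) y) ↔
      y = ⟨RingHom.ker (MvPolynomial.constantCoeff : B →+* k), RingHom.ker_isPrime _⟩ := by
    intro y
    rw [← xSing_fatPoint_iff hm' y, hX, ← comap_specMap_snd_ofIdealTop_prod A B]
    exact (xSing_comap_iff_of_smooth (Spec.map (CommRingCat.ofHom (algebraMap k (A × B))))
      (Spec.map (CommRingCat.ofHom (algebraMap k B))) (Spec.map (CommRingCat.ofHom (RingHom.snd A B)))
      (specMap_snd_comp_specMap_algebraMap A B k) _ y).symm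
  constructor
  · intro hz
    rcases exists_specMap_fst_or_snd_eq A B z with ⟨x, rfl⟩ | ⟨y, rfl⟩
    · exact Or.inl (by rw [(hl x).mp hz])
    · exact Or.inr (by rw [(hr y).mp hz])
  · rintro (rfl | rfl)
    · exact (hl _).mpr rfl
    · exact (hr _).mpr rfl

end FatPair

/-! ## The rule on a fat pair: hull values and centre support -/

namespace LexmaxHullRule

variable {p : ℕ} (R : LexmaxHullRule p)

/-- **Hull of a fat pair at the left origin** (rule with `HullComap`): `(2,…,2,⊤,…)` with `m` twos.
[OURS · folklore] -/
theorem hull_fatPair_inl (hR : R.HullComap) (k : Type) [Field k] [CharP k p] [PerfectField k]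
    {m m' : ℕ} (hm : 1 ≤ m) (hm' : 1 ≤ m') :
    R.hull (Spec.map (CommRingCat.ofHom
        (algebraMap k (MvPolynomial (Fin m) k × MvPolynomial (Fin m') k))))
      (Scheme.IdealSheafData.ofIdealTop
        ((((RingHom.ker (MvPolynomial.constantCoeff : MvPolynomial (Fin m) k →+* k)) ^ 2).prod
            ((RingHom.ker (MvPolynomial.constantCoeff : MvPolynomial (Fin m') k →+* k)) ^ 2)).map
          (Scheme.ΓSpecIso (.of (MvPolynomial (Fin m) k × MvPolynomial (Fin m') k))).inv.hom))
      (Spec.map (CommRingCat.ofHom (RingHom.fst _ _))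
          (⟨RingHom.ker (MvPolynomial.constantCoeff : MvPolynomial (Fin m) k →+* k),
            RingHom.ker_isPrime _⟩ : Spec (.of (MvPolynomial (Fin m) k)))) =
      chartProfile (m := m) 2 (fun _ => 1) := by
  set A := MvPolynomial (Fin m) k with hA
  set B := MvPolynomial (Fin m') k with hB
  have hsA : Smooth (Spec.map (CommRingCat.ofHom (algebraMap k A))) :=
    DatumToEmbedded.Negative.smooth_affineSpace k m
  have hsB : Smooth (Spec.map (CommRingCat.ofHom (algebraMap k B))) :=
    DatumToEmbedded.Negative.smooth_affineSpace k m'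
  haveI := hsA
  haveI := hsB
  haveI : Smooth (Spec.map (CommRingCat.ofHom (algebraMap k (A × B)))) :=
    smooth_specMap_algebraMap_prod A B k hsA hsB
  haveI := isOpenImmersion_specMap_fst A B
  have hsing := (xSing_fatPair_iff k hm hm' _).mpr (Or.inl rfl)
  have h := hR (Spec.map (CommRingCat.ofHom (algebraMap k (A × B))))
    (Spec.map (CommRingCat.ofHom (algebraMap k A))) (Spec.map (CommRingCat.ofHom (RingHom.fst A B)))
    (specMap_fst_comp_specMap_algebraMap A B k) _ _ hsing
  rw [← h, comap_specMap_fst_ofIdealTop_prod]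
  exact R.hull_fatPoint_eq hm k

/-- **Hull of a fat pair at the right origin** (rule with `HullComap`): `(2,…,2,⊤,…)` with `m'` twos.
[OURS · folklore] -/
theorem hull_fatPair_inr (hR : R.HullComap) (k : Type) [Field k] [CharP k p] [PerfectField k]
    {m m' : ℕ} (hm : 1 ≤ m) (hm' : 1 ≤ m') :
    R.hull (Spec.map (CommRingCat.ofHom
        (algebraMap k (MvPolynomial (Fin m) k × MvPolynomial (Fin m') k))))
      (Scheme.IdealSheafData.ofIdealTop
        ((((RingHom.ker (MvPolynomial.constantCoeff : MvPolynomial (Fin m) k →+* k)) ^ 2).prod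
            ((RingHom.ker (MvPolynomial.constantCoeff : MvPolynomial (Fin m') k →+* k)) ^ 2)).map
          (Scheme.ΓSpecIso (.of (MvPolynomial (Fin m) k × MvPolynomial (Fin m') k))).inv.hom))
      (Spec.map (CommRingCat.ofHom (RingHom.snd _ _))
          (⟨RingHom.ker (MvPolynomial.constantCoeff : MvPolynomial (Fin m') k →+* k),
            RingHom.ker_isPrime _⟩ : Spec (.of (MvPolynomial (Fin m') k)))) =
      chartProfile (m := m') 2 (fun _ => 1) := by
  set A := MvPolynomial (Fin m) k with hA
  set B := MvPolynomial (Fin m') k with hB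
  have hsA : Smooth (Spec.map (CommRingCat.ofHom (algebraMap k A))) :=
    DatumToEmbedded.Negative.smooth_affineSpace k m
  have hsB : Smooth (Spec.map (CommRingCat.ofHom (algebraMap k B))) :=
    DatumToEmbedded.Negative.smooth_affineSpace k m'
  haveI := hsA
  haveI := hsB
  haveI : Smooth (Spec.map (CommRingCat.ofHom (algebraMap k (A × B)))) :=
    smooth_specMap_algebraMap_prod A B k hsA hsB
  haveI := isOpenImmersion_specMap_snd A B
  have hsing := (xSing_fatPair_iff k hm hm' _).mpr (Or.inr rfl)
  have h := hR (Spec.map (CommRingCat.ofHom (algebraMap k (A × B))))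
    (Spec.map (CommRingCat.ofHom (algebraMap k B))) (Spec.map (CommRingCat.ofHom (RingHom.snd A B)))
    (specMap_snd_comp_specMap_algebraMap A B k) _ _ hsing
  rw [← h, comap_specMap_snd_ofIdealTop_prod]
  exact R.hull_fatPoint_eq hm' k

/-- **The rule's centre on a fat pair `T(m, m')` with `1 ≤ m < m'` is supported exactly on the LEFT
origin** (the smaller fat point, whose hull `(2,…,2[m],⊤,…)` is strictly larger). [OURS · folklore] -/
theorem centre_support_fatPair (hR : R.HullComap) (k : Type) [Field k] [CharP k p] [PerfectField k]
    {m m' : ℕ} (hm : 1 ≤ m) (hmm' : m < m') :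
    (R.centre (Spec.map (CommRingCat.ofHom
        (algebraMap k (MvPolynomial (Fin m) k × MvPolynomial (Fin m') k))))
      (Scheme.IdealSheafData.ofIdealTop
        ((((RingHom.ker (MvPolynomial.constantCoeff : MvPolynomial (Fin m) k →+* k)) ^ 2).prod
            ((RingHom.ker (MvPolynomial.constantCoeff : MvPolynomial (Fin m') k →+* k)) ^ 2)).map
          (Scheme.ΓSpecIso (.of (MvPolynomial (Fin m) k × MvPolynomial (Fin m') k))).inv.hom))).support =
      {Spec.map (CommRingCat.ofHom (RingHom.fst _ _))
          (⟨RingHom.ker (MvPolynomial.constantCoeff : MvPolynomial (Fin m) k →+* k),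
            RingHom.ker_isPrime _⟩ : Spec (.of (MvPolynomial (Fin m) k)))} := by
  have hm' : 1 ≤ m' := le_of_lt (lt_of_le_of_lt hm hmm')
  set A := MvPolynomial (Fin m) k with hA
  set B := MvPolynomial (Fin m') k with hB
  have hsA : Smooth (Spec.map (CommRingCat.ofHom (algebraMap k A))) :=
    DatumToEmbedded.Negative.smooth_affineSpace k m
  have hsB : Smooth (Spec.map (CommRingCat.ofHom (algebraMap k B))) :=
    DatumToEmbedded.Negative.smooth_affineSpace k m'
  haveI : Smooth (Spec.map (CommRingCat.ofHom (algebraMap k (A × B)))) :=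
    smooth_specMap_algebraMap_prod A B k hsA hsB
  have has := (xSing_fatPair_iff k hm hm' _).mpr (Or.inl rfl)
  refine R.centre_support_eq_singleton_of_hull_lt _ _ has
    (fun y hy => (xSing_fatPair_iff k hm hm' y).mp hy) ?_
  rw [R.hull_fatPair_inl hR k hm hm', R.hull_fatPair_inr hR k hm hm']
  exact twoProfile_lt_of_lt hmm'

end LexmaxHullRule

end Summit.ResolutionOfSingularities.ResolutionOfSingularities.Theorems.PointwiseLexmaxHull

end
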